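import Literature.Geometry.DiscreteGeometry.DelsarteLinearProgrammingBound

/-!
# Spherical codes: `A(23, 1/3) ≤ 4600` — sharp Delsarte LP certificate

Framing: lottery ticket; floor = certified bounds/negative ranges. Venture `PackingBounds`
(cell `pub-packcert`), spherical-code family, LP-sharp row.

Every finite set of unit vectors of `ℝ^23` with pairwise inner products `≤ 1/3` has at most `4600`
elements, and this is attained by the 4600-point code in ℝ²³ (kissing configuration of the Leech lattice minimal vectors) (inner products {±1/3, 0, -1}; a universally optimal,
LP-sharp configuration, Cohn–Kumar 2007, Table 1; Levenshtein's bound). Proof: the linear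
programming bound (`Literature.Geometry.DiscreteGeometry.DelsarteLP.card_le`) with the
Levenshtein-type polynomial `f(t) = (t + 1) · (t + 1 / 3)² · t² · (t - 1 / 3)` (degree 6), which is `≤ 0` on `[-1, 1/3]` by its
shape; its Gegenbauer coefficients for `S^22` (`μ = 21/2`, `C_k = gegenbauerSum 21/2 k`) are
`(8/15525, 8/14175, 328/1134567, 488/3151575, 1576/30320325, 32/1890945, 16/6513255)`, all nonnegative, and `f(1) = 4600 · f_0` EXACTLY (sharp). Exact rational certificate
generated and checked by two independent Gegenbauer implementations (cell code
`code/delsarte_exact.py`, `code/emit_codes.py`); the kernel re-verifies the identity and the value.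

## References
* H. Cohn, A. Kumar, *Universally optimal distribution of points on spheres*, J. Amer. Math. Soc.
  20 (2007) 99–148, Table 1. [`CohnKumar2006`]
* P. Delsarte, J. M. Goethals, J. J. Seidel, Geom. Dedicata 6 (1977) 363–388. [`DelsarteGoethalsSeidel1977`]
* V. I. Levenshtein, Soviet Math. Dokl. 20 (1979) 417–421. [`Levenshtein1979`]
-/

namespace Summit.Ventures.PackingBounds.SphericalCodes

open Finset Literature.Analysis.SpecialFunctions Literature.Geometry.DiscreteGeometry

/-- **`A(23, 1/3) ≤ 4600`** (sharp; attained by the 4600-point code in ℝ²³ (kissing configuration of the Leech lattice minimal vectors)): a finite set of unit vectors of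
`ℝ^23` with pairwise inner products `≤ 1/3` has at most `4600` elements. Delsarte LP certificate
`f(t) = (t + 1) · (t + 1 / 3)² · t² · (t - 1 / 3)`, `f(1)/f_0 = 4600` exactly. [cite: CohnKumar2006, Table 1] -/
theorem code_dim23_le_4600 (C : Finset (EuclideanSpace ℝ (Fin 23)))
    (h1 : ∀ x ∈ C, ‖x‖ = 1) (h2 : ∀ x ∈ C, ∀ y ∈ C, x ≠ y → inner ℝ x y ≤ 1 / 3) :
    C.card ≤ 4600 := by
  refine DelsarteLP.card_le (n := 23) (μ := (21 / 2)) (by norm_num) (by norm_num) 6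
    (fun k => match k with
      | 0 => 8 / 15525 | 1 => 8 / 14175 | 2 => 328 / 1134567 | 3 => 488 / 3151575
      | 4 => 1576 / 30320325 | 5 => 32 / 1890945 | 6 => 16 / 6513255 | _ => 0)
    ?_ (1 / 3) ?_ 4600 (by norm_num) ?_ C h1 h2
  · intro k
    split <;> norm_num
  · intro t ht1 ht2
    have key : (t + 1) * (t + 1 / 3) ^ 2 * t ^ 2 * (t - 1 / 3) ≤ 0 :=
      mul_nonpos_of_nonneg_of_nonpos (mul_nonneg (mul_nonneg (by linarith) (by positivity)) (by positivity)) (by linarith)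
    have hsum : ∑ k ∈ range (6 + 1),
        (fun k => match k with
      | 0 => 8 / 15525 | 1 => 8 / 14175 | 2 => 328 / 1134567 | 3 => 488 / 3151575
      | 4 => 1576 / 30320325 | 5 => 32 / 1890945 | 6 => 16 / 6513255 | _ => 0) k * gegenbauerSum ((21 / 2) : ℝ) k t =
        (t + 1) * (t + 1 / 3) ^ 2 * t ^ 2 * (t - 1 / 3) := by
      simp [Finset.sum_range_succ, gegenbauerSum, gegenbauerCoeff, Finset.prod_range_succ,
        Nat.factorial]
      ring
    rw [hsum]
    exact key
  · norm_num [Finset.sum_range_succ, gegenbauerSum, gegenbauerCoeff, Finset.prod_range_succ,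
      Nat.factorial]

end Summit.Ventures.PackingBounds.SphericalCodes
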